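import Summits.QuantumFields.YangMills.Theorems.UnitScaleTiltHalvingHSiteTopOfDatumGamma
import Summits.QuantumFields.YangMills.Theorems.UnitScaleTiltHalvingHSiteDatumOfSocketsTGammaTree
import Summits.QuantumFields.YangMills.Theorems.UnitScaleTiltHalvingHSiteDatumRowsGamma
import Summits.QuantumFields.YangMills.Theorems.UnitScaleTiltHalvingHSiteTopKnit
import Summits.QuantumFields.YangMills.Theorems.UnitScaleTiltHalvingHSiteTopH42OfRowsGammaD
import Summits.QuantumFields.YangMills.Theorems.UnitScaleTiltHalvingHSiteTopKnitBP
import Summits.QuantumFields.YangMills.Theorems.UnitScaleTiltHalvingHSiteSizeRowsOfTopRowsGamma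
import HarnessLib

/-!
# `hP1room` PROGRAMME — EDITION γ, FILE (γ-3) v3.2: ★★★ THE PER-SITE COMPOSER FOR `2 ≤ K − n` WITH THE (1.29) ROWS (R1)(R2) INSIDE THE COLLAR SOCKET

Route `UnitScaleTilt`, crux K1 child «MinimiserStabilityRegPr» (stmt-QuantumFields-19200), registered stub `stub_halvingStep` (`BirthV10`), display v7γ
(LEAD-H ✓p686336).  Cell `ym3-torus` (HUMAN RULING D-0037: YM₃ on T³ is rung R3 — NOT d = 4, NOT infinite volume, NOT a mass gap, NOT the Clay problem), width seat
`ym-ust-19200-w3` gen 10.  `--supports stmt-QuantumFields-19200 --as helper`; THEOREMS ONLY (0 `def`, 0 `sorry`); count-neutral; nothing here claims the sockets, the stub or the gap.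

WHAT.  ★★★ `siteRows_of_socketsTγR` = ✓p683858 `HalvingHSiteRowsOfSocketsTGammaT.siteRows_of_socketsTγT` (composer k ≥ 2 v3.1: sockets `hT4Tγ`, `hBbd hBd` + `H59Dγ`,
`SLetτ`, `HTOP`, `H42topCrossT`, `H59γ`, γ windows — see ITS docstring and ✓p681135's for (a)–(d)) with the DATUM-CLOSED collar socket `H42topCrossT` WEAKENED by three
more antecedents — a FOURTH guard on `gJ` right after J3's tower row, and two rows after the (1.108) row before the `∀ (u, V′, A′)` tail (ym-ust-20520-w5 g9, bus 2026-08-29 00:50:38Z ∕ 01:20:38Z, «prerequisite of ANY discharge along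
[Balaban1985Averaging] (84)∕(86)»; complete row list 01:35:38Z∕01:36:05Z with ★w3-20520 g8): **(R3)** J3 (c′) «the top average `Ũ♯^{(k)}` is `1` on the `tLo a ρ′`-rooted
tree bonds of □̃^{(k)}» (✓`P1FlatCorePreGauge.exists_preGauge_flat` conj. 5, re-exported by ✓`siteDatum_of_T4Tγ_tree`), **(R1)** `Restr129 L k (cubeLamS … k k) 1 u₁` — the datum gauge's (1.29) AT the truncation `k = K − n` (from Theorem 4's (1.29) at `k − 1` by
the truncation law (1.68), lit ✓`restr129_succ_of_truncation`), and **(R2)** `Restr129 L k (update (cubeLamS … k k) k ∅) 1 (u₁·e^{iλ′})` — the composite gauge's (1.29) with the top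
family EMPTIED ((1.78)–(1.79); ✓`HalvingP1FlatCoreSupplierRestr129.restr129_product_of_topRows`).  All three rows are CONSUMER-HELD: (R3) is the datum supplier's 4th J3 row; (R1)(R2) the composer derives from the datum's `h129`, J3's
guards, the datum chart, the top step's `(1.108)`∕`(lo)` rows and the JOIN windows it already displays — exactly as ✓`siteSizeRows_of_topRows_γ` does internally — so NO window, letter
or socket other than `H42topCrossT` changes; the CONCLUSION is ✓p668452's 22 rows VERBATIM.  Why the inhabitant needs them (w5 LOCATE-2 61dadb20 §1∕§3): at a crossing top bond
`c = ⟨y_out, y_in⟩` the double-bar variable factors as `E(y_out)⁻¹·Ũ♯(c)·E(y_in)` with `E = (R̄₀u)^{(k)}`; (R2) gives `E(y_out) = 1` on the collar block, (R1) + `htopId` give `E(y_in)`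
through the knit frame.  HONEST SCOPE: by-name composition + window arithmetic; the (M2′) estimate itself, Prop. 3∕5, Theorem 4, [4] Thm 3.3 and the stub are NOT proved here.

References: T. Bałaban, CMP **99** (1985) 75–102 [Balaban1985RegularSpaces] (Prop. 5 (1.106)–(1.109) p.94, Thm 4 p.88, Prop. 3 (1.36)–(1.42) pp.82–83, (1.29) p.81, (1.57)–(1.59)
p.86, (1.68)–(1.69) p.88, (1.78)–(1.79) p.90, (1.131) p.99); CMP **99** (1985) 389–434 [Balaban1985BackgroundPropagators] (Thm 3.1 p.397, Thm 3.3 p.398); CMP **96** (1984) 223–250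
[Balaban1984PropagatorsII] ((2.3) p.224); CMP **102** (1985) 277–309 [Balaban1985Variational] ((150)–(156) pp.301–302); CMP **98** (1985) 17–51 [Balaban1985Averaging] (Prop. 4 p.38,
(19)–(23) pp.20–21, (84)–(86) p.33).
-/

set_option autoImplicit false

noncomputable section

open scoped BigOperators Matrix.Norms.L2Operator
open NormedSpace  open Complex (I)

namespace Summit.QuantumFields.YangMills.Theorems.HalvingHSiteRowsOfSocketsTGammaR

open Literature.MathematicalPhysics.QuantumFieldTheory.Balaban1983to89  open Literature.MathematicalPhysics.QuantumFieldTheory.Balaban1983to89.T3ContinuumYM3Torus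
open Literature.MathematicalPhysics.QuantumFieldTheory.Balaban1983to89.T3PrintedRegularMinimiser (RegPr regFibrePr)  open MatrixLog (mlog)  open B5Eq118OneStroke (iterBlockOf)  open B7Prop1Explicit (e expUnit)  open B7Prop1Explicit renaming Site → LSite
open B7Prop2Explicit (unitaryUnits C0 c2' avgIter)  open B7Prop2SpecialUnitary (specialUnitaryUnits mem_specialUnitaryUnits specialUnitaryUnits_le_unitaryUnits)  open B7Prop3Flat (c3)  open B7Prop10General (C6 C4G)  open B7Prop9Flat (C5')  open B7Prop1Local (InBox loK bondHiK)
open B7Eq78Linearization (conjR zdBlocking QprimeIter)  open B7Eq92Concrete (mgauge)  open B8Ineq130 (tlo thi)  open B8Ineq132 (covDerivFwd InAk)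
open B8Eq119TwistedAxial (Restr129 InAx bgT)  open B8Eq131Cubes (cube gs tLo tHi)  open B8Eq131CubesAdmissible (cubeFam)  open B8CubeMemberZd (cubeLamS cubeLamB)  open B8Eq184Proof (gaugeExp cfgExp)  open B8Eq182Proof (gAd)  open B8Eq188Proof (frakF3)  open B8Eq140Level (SideTouches)
open B8Eq146AExpansion (iEta)  open B8Eq138LandauZd (IsLandau138W covDivB covLap QT logCfg)  open B7Prop4GeneralLevels (logCovIter linCovIter)  open B8Eq155JBound (Jcur wsup)  open B8ScaledSupNorm (bondNorm msup)  open B8Ineq125Concrete (C2p)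
open B8Eq1117Concrete (XSpace)  open B9SupplySockB9P3ZdBeta (CrossB)  open B9SupplySockB9P3ZdGamma (cubeLamBP')  open B8Ineq132 (BondTouches)
open HalvingHSiteDatumRowsGamma (datumRowsγ h66_of_towerRow betaScalarRows)  open B8Prop5ContractionKLevel (Bd2 Mc Kc)  open B8LambdaSpaceKLevel (wt)  open B8Eq178Averages (Qnl)  open B8SpecialUnitaryTrace (trCLM trCLM_apply)
open B10Eq27TorusAxialLog (transl rel pull pull_apply unitsField toUField suIncl gaugeActT axialT unitsField_mem_unitaryUnits)  open B15Eq112TorusCover (lift cover)  open Node00 (coverAt)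
open LatticeFieldCalculus (siteAvgIter)  open Summit.QuantumFields.YangMills.Theorems.Prop8ChartDoubleBar (dbarIterU vframeU)  open P1FlatCoreCubeInclusion (corner_of_offset)  open HalvingP1FlatCoreSupplierAssembly (hchartTop_of_hdat hc₁_of_small)
open HalvingHSiteSizeRowsOfTopRowsGamma (siteSizeRows_of_topRows_γ)  open HalvingHSiteTopKnit (hknit_of_descent)  open HalvingHSiteDatumOfSocketsTGammaTree (siteDatum_of_T4Tγ_tree)  open B8Lemma1NonAbelian (lowPart)  open HalvingHSiteTopH42OfRowsGammaD (H42_of_rows_γD)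
open HalvingHSiteTopKnitBP (hknit_of_descent_BP')  open B8CubeMemberZd (hΩ_cubeFam)  open B8SockHFPCubeMember (htw_cubeLamS h8lt_cubeLamS h8top_cubeLamS)  open B8Prop6OfThm4 (one_inAk)
open HalvingP1FlatCoreSupplierRestr129 (restr129_product_of_topRows)  open HalvingP1FlatCoreSupplierInduction (h34_of_inAk_univ hAx_of_inAx_one)  open B8Prop5SocketDatum (restr129_succ_of_truncation)  open P1FlatCoreTopH42Gamma (cubeLamB_top_subset_cubeLamBP')  open B7Prop4Flat (C2 c4)  open HalvingHSiteTopOfDatumGamma (siteTop_of_datum_γ)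

variable (F : T3Family) {n K : ℕ}

set_option maxHeartbeats 400000 in
/-- ★★★ **THE PER-SITE COMPOSER FOR `2 ≤ K − n`, EDITION γ, v3.2 (FILE (γ-3))** — see the module docstring: `hMember`'s 22-row ∃-body VERBATIM at one site from the
displayed windows and the sockets `hT4Tγ H59Dγ SLetτ HTOP H42topCrossT H59γ` (print's split class `cubeLamBP′`, support clauses, collar allowance; `H42topCrossT` carries (R1)(R2)).
[cite: Balaban1985RegularSpaces, Prop. 5 (1.106)-(1.109) p.94, Thm 4 p.88, Prop. 3 (1.36)-(1.42) pp.82-83, (1.57)-(1.59) p.86, (1.131) p.99; Balaban1985BackgroundPropagators, Thm 3.1 p.397, Thm 3.3 p.398; Balaban1984PropagatorsII, (2.3) p.224; Balaban1985Variational, (150)-(156) pp.301-302; Balaban1985Averaging, Prop. 4 p.38, (19)-(23) pp.20-21, (208)-(214) p.50] -/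
theorem siteRows_of_socketsTγR (L : ℕ) (hF : F.L = L) (hnK : n < K) (h2 : 2 ≤ K - n)
    (ρ S M M' : ℕ) {ρ' : ℕ} (hρ'def : ρ' = ρ + M + L + S) {ε₀ : ℝ} (hε₀ : 0 < ε₀) (hε : 10 ^ 7 * (F.L : ℝ) ^ 3 * ε₀ ≤ 1)
    {s : ℝ} (hsdef : s = (198 + 12 * (((M' : ℝ) - 1) + 4 * ρ')) * ε₀) (hs6 : s ≤ 1 / 6)
    (hroom : 2 * ρ + (M' + 1 + 2 * (M + L + S)) ≤ F.L ^ (F.m + n))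
    (V : GaugeField (F.P n) 0 (Matrix.specialUnitaryGroup (Fin 2) ℂ)) (U : GaugeField (F.P K) 0 (Matrix.specialUnitaryGroup (Fin 2) ℂ))
    (hU : U ∈ regFibrePr F n K hnK.le ε₀ V) (x₀ : Site (F.P K) 0)
    {t : ℤ} (ht0 : 0 ≤ t) (ht : t ≤ (M' : ℤ) - 1)
    {a : LSite (F.P K).d} (hadef : a = fun μ => ((iterBlockOf (K - n) x₀ μ).val : ℤ) - t)
    -- the schedule letters, socket constants, size letter `Bsz`, and ALL scalar windows (Prop. 3 at `(ε₀, c⋆)`∕`(ε₀, 2(L·c⋆)+8α₄)`, JOIN, family, torus, trace; + the γ rows) — DISPLAYED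
    {α₁ B₀ B₀' cstar α₄ C₂ σ δ ω τ₀ cB cA cDA Cb Cl B₀'H B₂' BG BR Bbd Bsz : ℝ} {m₀ : ℕ}
    (hα₁ : 0 < α₁) (hB₀ : 0 < B₀) (hB₀' : 0 < B₀') (hB₀'H : 0 < B₀'H) (hB₂' : 0 ≤ B₂') (hBG : 0 ≤ BG) (hBR : 0 ≤ BR) (hsα₁ : s ≤ α₁)
    (hc : cstar = 5 * ((F.P K).d : ℝ) * (F.P K).L * B₀ * (ε₀ + α₁))
    (hα₄ : α₄ = 8 * B₀' * (5 * ((F.P K).d : ℝ) * (F.P K).L * B₀) * (ε₀ + α₁)) (hs₂ : (F.P K).L * cstar ≤ 1 / 12)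
    (hside₀ : 36 * (F.P K).d * B₀ * cstar ≤ 1 / 2)
    (hC₂ : 8 * (131072 * (((F.P K).d : ℝ) + 1) ^ 2) * Real.exp (4 * (800 * (((F.P K).d : ℝ) + 1) ^ 2 * (((F.P K).d : ℝ) + 4)) * (((F.P K).L : ℝ) ^ 2 * ε₀)) * ((F.P K).L : ℝ) ^ 2 ≤ C₂)
    (h61₀ : 2 * cstar ^ 2 + 20 * (F.P K).d * ε₀ * cstar + 2 * C₂ * cstar ^ 2 ≤ ε₀ + α₁) (hsmall₁ : ((F.P K).d : ℝ) * (F.P K).L * α₁ ≤ 1 / 8)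
    (hα3 : C0 (F.P K).d * ε₀ ≤ 1 / 3) (hα4 : 4 * ε₀ ≤ c2' (F.P K).d (F.P K).L)
    -- EDITION γ: [3] Prop. 4's windows ONE LEVEL LOWER, at `(L²ε₀, L·c⋆)` (the γ JOIN's) and at `(L²ε₀, L·(2(L·c⋆) + 8α₄))` (T4γ's)
    (hα3γ : C0 (F.P K).d * (((F.P K).L : ℝ) ^ 2 * ε₀) ≤ 1 / 3) (hα4γ : 4 * (((F.P K).L : ℝ) ^ 2 * ε₀) ≤ c2' (F.P K).d (F.P K).L) (h16γ : 16 * (((F.P K).L : ℝ) * cstar) ≤ 1)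
    (hsmallγ : Real.exp (4 * (800 * (((F.P K).d : ℝ) + 1) ^ 2 * (((F.P K).d : ℝ) + 4)) * (((F.P K).L : ℝ) ^ 2 * ε₀))
      * (1 + 8 * (131072 * (((F.P K).d : ℝ) + 1) ^ 2) * (((F.P K).L : ℝ) * cstar)) ≤ 2)
    (hc₃γ : 2 * (((F.P K).L : ℝ) * cstar) ≤ c3 (F.P K).d (F.P K).L)
    (hsmallPγ : Real.exp (4 * (800 * (((F.P K).d : ℝ) + 1) ^ 2 * (((F.P K).d : ℝ) + 4)) * (((F.P K).L : ℝ) ^ 2 * ε₀))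
      * (1 + 8 * (131072 * (((F.P K).d : ℝ) + 1) ^ 2) * (((F.P K).L : ℝ) * (2 * ((F.P K).L * cstar) + 8 * α₄))) ≤ 2)
    (hc₃Pγ : 2 * (((F.P K).L : ℝ) * (2 * ((F.P K).L * cstar) + 8 * α₄)) ≤ c3 (F.P K).d (F.P K).L)
    (h16Pγ : 16 * (((F.P K).L : ℝ) * (2 * ((F.P K).L * cstar) + 8 * α₄)) ≤ 1)
    (h16 : 16 * (2 * ((F.P K).L * cstar) + 8 * α₄) ≤ 1) (hd5 : 5 * (2 * ((F.P K).L * cstar) + 8 * α₄) * (((F.P K).d : ℝ) - 1) ≤ 4)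
    (hside : 36 * (F.P K).d * B₀ * (2 * ((F.P K).L * cstar) + 8 * α₄) ≤ 1 / 2)
    (h50 : 50 * (F.P K).d * (2 * ((F.P K).L * cstar) + 8 * α₄) ≤ 1)
    (h61 : 2 * (2 * ((F.P K).L * cstar) + 8 * α₄) ^ 2 + 20 * (F.P K).d * ε₀ * (2 * ((F.P K).L * cstar) + 8 * α₄) + 2 * C₂ * (2 * ((F.P K).L * cstar) + 8 * α₄) ^ 2 ≤ ε₀ + α₁)
    (hcBlo : (F.P K).L * cstar ≤ cB) (hcAlo : (F.P K).L * cstar ≤ cA) (hcDAlo : ((F.P K).d : ℝ) * ((F.P K).L : ℝ) ^ 2 * cstar ≤ cDA)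
    (hsmall : Real.exp (4 * (800 * (((F.P K).d : ℝ) + 1) ^ 2 * (((F.P K).d : ℝ) + 4)) * ε₀) * (1 + 8 * (131072 * (((F.P K).d : ℝ) + 1) ^ 2) * cB) ≤ 2)
    (hc₃ : 2 * cB ≤ c3 (F.P K).d (F.P K).L) (hsc : 2048 * ((F.P K).d : ℝ) * cB ≤ 1) (hα₃' : 40 * (F.P K).d * cB ≤ 1 / 200)
    (hs₁ : 200 * C6 (F.P K).d * (2 * α₄) ≤ 1) (hs₂' : 12000 * (((F.P K).d : ℝ) + 1) * (F.P K).L * (2 * α₄) ≤ 1)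
    (hs₃ : C4G (F.P K).d (F.P K).L * (ε₀ + 40 * (F.P K).d * cB + 4 * (2 * α₄)) ≤ 1)
    (hs₄ : 1024 * (((F.P K).d : ℝ) + 1) * (((F.P K).d : ℝ) + 4) * (F.P K).L ^ 2 * ε₀ ≤ 1)
    (hs₅ : 32 * (((F.P K).d : ℝ) + 1) ^ 2 * C6 (F.P K).d * (F.P K).L ^ 2 * ε₀ ≤ 1)
    (hs₆ : 16 * (F.P K).d * C5' (F.P K).d * C6 (F.P K).d * ((F.P K).L : ℝ) ^ 2 * ε₀ ≤ 1) (hs₇ : 8 * (F.P K).d * C6 (F.P K).d * (F.P K).L * ε₀ ≤ 1)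
    (hprod8 : 2 * C6 (F.P K).d * (40 * (F.P K).d * cB + 4 * α₄) ≤ 1 / 8)
    (hα70 : α₄ ≤ 1 / 70) (hcA0 : 0 ≤ cA) (hcA12 : cA ≤ 1 / 12) (hcA13 : cA ≤ 1 / 13)
    (hCblo : C2p (F.P K).d * (40 * (F.P K).d * cB + α₄) * α₄ ≤ Cb) (hCllo : 2 * C2p (F.P K).d * (40 * (F.P K).d * cB + 2 * α₄) ≤ Cl)
    (hCbρ : Cb ≤ α₄ / (2 * B₀'H)) (hClB : Cl * B₀'H ≤ 1 / 2)
    (hσ : 2 * (F.P K).L * cstar ≤ σ)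
    (hδ : δ = 8 * ((((F.P K).d + 2) * (F.P K).L : ℕ) : ℝ) * σ) (hω : ω = ((F.P K).d : ℝ) * (F.P K).L * α₄ / 2) (hτ₀ : τ₀ = 16 * m₀ * σ)
    (hbudget : 8 * 3800 * ((((F.P K).d + 2) * (F.P K).L : ℕ) : ℝ) ^ 2 * σ ≤ 1) (hm : 32 * (m₀ : ℝ) * σ ≤ 1)
    (hm₀ : (F.P K).d * (M' + ρ') ≤ m₀) (hr : 160 * (α₄ + δ + 11 * ω) ≤ 1 / 4)
    (hCb₀ : 640 * (α₄ + δ + 5 * ω) * ω ≤ Cb) (hCl₀ : 10240 * (((F.P K).d : ℝ) * (F.P K).L) * (α₄ + δ + 11 * ω) ≤ Cl)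
    (hwin : ∀ τ : ℝ, 0 ≤ τ → τ ≤ τ₀ → B₀'H * τ < α₄ / 4 ∧ α₄ / 4 + B₀'H * (Cb + τ) ≤ 1 / 24 ∧ α₄ / 4 + B₀'H * (Cb + τ) ≤ 1 / 140 ∧
      10 * (α₄ / 4 + B₀'H * (Cb + τ)) * BR ≤ 1 / 2 ∧ B₀'H * (Cb + τ) ≤ 3 * α₄ / 4 ∧ BG * Mc (F.P K).d BR (α₄ / 4 + B₀'H * (Cb + τ)) cA (B₂' * (Cb + τ)) cDA ≤ α₄ / 4 ∧
      BG * Kc (F.P K).d BR (α₄ / 4 + B₀'H * (Cb + τ)) cA (B₂' * (Cb + τ)) cDA (B₂' * (2 * Cl)) (1 + B₀'H * (2 * Cl)) (1 + B₀'H * (2 * Cl)) ≤ 1 / 2)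
    (hcsB : cstar ≤ Bsz * ε₀)
    -- the knit ∕ read ∕ (1.42) windows of ✓p666867 (schedule letters; `r := e^{2α₄}((e^{c₁} − 1) + α₄L^{−k})`, `c₁ := c⋆·L^{−(k−1)}`) and the top-log letter `ttop`
    (hkb : (2 * ((F.P K).L * cstar) + 8 * α₄) ≤ c4 (F.P K).d) (hbudget42 : 243200 * ((((F.P K).d + 2) * (F.P K).L : ℕ) : ℝ) ^ 2 * (2 * ((F.P K).L * cstar) + 8 * α₄) ≤ 1)
    {ttop : ℝ} (hr42 : Real.exp (2 * α₄) * ((Real.exp (cstar * (((F.P K).L : ℝ) ^ (K - n - 1))⁻¹) - 1) + α₄ * (((F.P K).L : ℝ) ^ (K - n))⁻¹) ≤ 1 / 2)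
    (hr2 : 2 * (Real.exp (2 * α₄) * ((Real.exp (cstar * (((F.P K).L : ℝ) ^ (K - n - 1))⁻¹) - 1) + α₄ * (((F.P K).L : ℝ) ^ (K - n))⁻¹)) ≤ (2 * ((F.P K).L * cstar) + 8 * α₄) * (((F.P K).L : ℝ) ^ (K - n))⁻¹)
    (hwin42 : ttop + (C2 (F.P K).d + 64 * 60800 * ((((F.P K).d + 2) * (F.P K).L : ℕ) : ℝ) ^ 2) * (2 * ((F.P K).L * cstar) + 8 * α₄) ^ 2 < 2 * ((F.P K).d : ℝ) * (F.P K).L * α₁)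
    -- SOCKET `HTOP` (design (D2)): top double-bar logs of `(U♯)^{g′}` at the knit gauge `≤ t`, ∀-closed over the witnesses with ∃-body rows 1,2,4–9,14,15,19 as antecedents
    (HTOP : ∀ (gJ : GaugeTransf (F.P K) 0 (Matrix.specialUnitaryGroup (Fin 2) ℂ)) (u₁ : LSite (F.P K).d → (Matrix (Fin 2) (Fin 2) ℂ)ˣ)
        (W : LSite (F.P K).d → Fin (F.P K).d → (Matrix (Fin 2) (Fin 2) ℂ)ˣ) (A : LSite (F.P K).d → Fin (F.P K).d → Matrix (Fin 2) (Fin 2) ℂ) (c₁ c' : ℝ)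
        (κf : (Site (F.P K) 0 → Matrix (Fin 2) (Fin 2) ℂ) → (i : ℕ) → GaugeTransf (F.P K) i (Matrix (Fin 2) (Fin 2) ℂ)ˣ) (lam : LSite (F.P K).d → Matrix (Fin 2) (Fin 2) ℂ),
      (∀ z, ((u₁ z : (Matrix (Fin 2) (Fin 2) ℂ)ˣ) : Matrix (Fin 2) (Fin 2) ℂ) ∈ Matrix.specialUnitaryGroup (Fin 2) ℂ) →
      mgauge (1 : LSite (F.P K).d → Fin (F.P K).d → (Matrix (Fin 2) (Fin 2) ℂ)ˣ) u₁ W = pull (unitsField (toUField (GaugeField.gaugeAct gJ U))) 0 →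
      0 ≤ c' → 8 * 3800 * ((((F.P K).d + 2) * (F.P K).L : ℕ) : ℝ) ^ 2 * c' ≤ 1 → Real.exp c₁ - 1 ≤ ((F.L : ℝ)⁻¹) ^ (K - n) * c' →
      (∀ z ∈ cube (F.P K).L a M' ρ' (K - n) (K - n), ∀ ν : Fin (F.P K).d, W z ν = cfgExp (((F.L : ℝ)⁻¹) ^ (K - n)) A z ν ∧ ((F.L : ℝ)⁻¹) ^ (K - n) * ‖A z ν‖ ≤ c₁) →
      (∀ (m : Site (F.P K) 0 → Matrix (Fin 2) (Fin 2) ℂ) (i : ℕ) (y : Site (F.P K) (i + 1)), κf m (i + 1) y = (vframeU (gaugeActT (κf m i) (dbarIterU i (gaugeActT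
          (fun s => (u₁ (lift (F.P K) x₀ + rel x₀ s))⁻¹ * Unitary.toUnits (suIncl (gJ s)) : GaugeTransf (F.P K) 0 (Matrix (Fin 2) (Fin 2) ℂ)ˣ)
          (unitsField (toUField U))))) y)⁻¹ * κf m i (emb y) * vframeU (dbarIterU i (gaugeActT
            (fun s => (u₁ (lift (F.P K) x₀ + rel x₀ s))⁻¹ * Unitary.toUnits (suIncl (gJ s)) : GaugeTransf (F.P K) 0 (Matrix (Fin 2) (Fin 2) ℂ)ˣ) (unitsField (toUField U)))) y) →
      (∀ (m : Site (F.P K) 0 → Matrix (Fin 2) (Fin 2) ℂ) (x : Site (F.P K) 0), ((κf m 0 x : (Matrix (Fin 2) (Fin 2) ℂ)ˣ) : Matrix (Fin 2) (Fin 2) ℂ) = exp (m x)) →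
      (∀ x, IsSelfAdjoint (lam x)) → (∀ x, (lam x).trace = 0) → (∀ yc ∈ cubeLamS (F.P K).L a M' ρ' (K - n) (K - n) (K - n),
        κf (((-I) • lam) ∘ fun s : Site (F.P K) 0 => lift (F.P K) x₀ + rel x₀ s) (K - n) (coverAt (F.P K) (K - n) yc) = axialT (dbarIterU (K - n) (gaugeActT
            (fun s => (u₁ (lift (F.P K) x₀ + rel x₀ s))⁻¹ * Unitary.toUnits (suIncl (gJ s)) : GaugeTransf (F.P K) 0 (Matrix (Fin 2) (Fin 2) ℂ)ˣ)
            (unitsField (toUField U)))) (iterBlockOf (K - n) x₀) (coverAt (F.P K) (K - n) yc)) → ∀ c ∈ cubeLamB (F.P K).L a M' ρ' (K - n) (K - n) (K - n),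
        ‖mlog ((dbarIterU (K - n) (gaugeActT (fun s => ((u₁ * gaugeExp lam) (lift (F.P K) x₀ + rel x₀ s))⁻¹ * Unitary.toUnits (suIncl (gJ s)) :
              GaugeTransf (F.P K) 0 (Matrix (Fin 2) (Fin 2) ℂ)ˣ) (unitsField (toUField U)))
            ⟨coverAt (F.P K) (K - n) c.1, c.2⟩ : (Matrix (Fin 2) (Fin 2) ℂ)ˣ) : Matrix (Fin 2) (Fin 2) ℂ)‖ ≤ ttop)
    -- SOCKET `H42topCrossT` (v3.2, DATUM-CLOSED + (R1)(R2)): (1.42) on the level-`k` COLLAR bonds of print's class at the knit gauge OF THE DATUM — ∀ gJ (guards), datum + top objects WITH rows + (1.29) of `u₁`∕`u₁·e^{iλ′}`, then ∀ (u, V′, A′)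
    (H42topCrossT : ∀ (gJ : GaugeTransf (F.P K) 0 (Matrix.specialUnitaryGroup (Fin 2) ℂ)) (u₁ : LSite (F.P K).d → (Matrix (Fin 2) (Fin 2) ℂ)ˣ)
        (W : LSite (F.P K).d → Fin (F.P K).d → (Matrix (Fin 2) (Fin 2) ℂ)ˣ) (A : LSite (F.P K).d → Fin (F.P K).d → Matrix (Fin 2) (Fin 2) ℂ) (c₁ c' : ℝ)
        (κf : (Site (F.P K) 0 → Matrix (Fin 2) (Fin 2) ℂ) → (i : ℕ) → GaugeTransf (F.P K) i (Matrix (Fin 2) (Fin 2) ℂ)ˣ) (lam : LSite (F.P K).d → Matrix (Fin 2) (Fin 2) ℂ),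
      InAk (F.P K).L (K - n) (((F.L : ℝ)⁻¹) ^ (K - n)) ε₀ (fun _ => (Set.univ : Set (LSite (F.P K).d))) (pull (unitsField (toUField (GaugeField.gaugeAct gJ U))) 0) →
      (∀ m', m' ≤ K - n → ∀ Λ : ℕ → Set (LSite (F.P K).d), InAx (F.P K).L m' Λ (1 : LSite (F.P K).d → Fin (F.P K).d → (Matrix (Fin 2) (Fin 2) ℂ)ˣ) (pull (unitsField (toUField (GaugeField.gaugeAct gJ U))) 0)) →
      (∀ m', m' ≤ K - n → ∀ (x : LSite (F.P K).d) (ν : Fin (F.P K).d), tlo (F.P K).L (tLo a ρ') m' ≤ x → x + e ν ≤ thi (F.P K).L (tHi a M' ρ') m' →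
        ‖((avgIter (F.P K).L (pull (unitsField (toUField (GaugeField.gaugeAct gJ U))) 0) (K - n - m') x ν : (Matrix (Fin 2) (Fin 2) ℂ)ˣ) : Matrix (Fin 2) (Fin 2) ℂ) - 1‖ < s) →
      (∀ (x : LSite (F.P K).d) (ν : Fin (F.P K).d), tLo a ρ' ≤ x → x + e ν ≤ tHi a M' ρ' → lowPart ν (x - tLo a ρ') = 0 →
        avgIter (F.P K).L (pull (unitsField (toUField (GaugeField.gaugeAct gJ U))) 0) (K - n) x ν = 1) →
      (∀ z, ((u₁ z : (Matrix (Fin 2) (Fin 2) ℂ)ˣ) : Matrix (Fin 2) (Fin 2) ℂ) ∈ Matrix.specialUnitaryGroup (Fin 2) ℂ) →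
      mgauge (1 : LSite (F.P K).d → Fin (F.P K).d → (Matrix (Fin 2) (Fin 2) ℂ)ˣ) u₁ W = pull (unitsField (toUField (GaugeField.gaugeAct gJ U))) 0 →
      0 ≤ c' → 8 * 3800 * ((((F.P K).d + 2) * (F.P K).L : ℕ) : ℝ) ^ 2 * c' ≤ 1 → Real.exp c₁ - 1 ≤ ((F.L : ℝ)⁻¹) ^ (K - n) * c' →
      (∀ z ∈ cube (F.P K).L a M' ρ' (K - n) (K - n), ∀ ν : Fin (F.P K).d, W z ν = cfgExp (((F.L : ℝ)⁻¹) ^ (K - n)) A z ν ∧ ((F.L : ℝ)⁻¹) ^ (K - n) * ‖A z ν‖ ≤ c₁) →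
      (∀ (m : Site (F.P K) 0 → Matrix (Fin 2) (Fin 2) ℂ) (i : ℕ) (y : Site (F.P K) (i + 1)), κf m (i + 1) y = (vframeU (gaugeActT (κf m i) (dbarIterU i (gaugeActT
          (fun s => (u₁ (lift (F.P K) x₀ + rel x₀ s))⁻¹ * Unitary.toUnits (suIncl (gJ s)) : GaugeTransf (F.P K) 0 (Matrix (Fin 2) (Fin 2) ℂ)ˣ)
          (unitsField (toUField U))))) y)⁻¹ * κf m i (emb y) * vframeU (dbarIterU i (gaugeActT
            (fun s => (u₁ (lift (F.P K) x₀ + rel x₀ s))⁻¹ * Unitary.toUnits (suIncl (gJ s)) : GaugeTransf (F.P K) 0 (Matrix (Fin 2) (Fin 2) ℂ)ˣ) (unitsField (toUField U)))) y) →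
      (∀ (m : Site (F.P K) 0 → Matrix (Fin 2) (Fin 2) ℂ) (x : Site (F.P K) 0), ((κf m 0 x : (Matrix (Fin 2) (Fin 2) ℂ)ˣ) : Matrix (Fin 2) (Fin 2) ℂ) = exp (m x)) →
      (∀ x, IsSelfAdjoint (lam x)) → (∀ x, (lam x).trace = 0) → (∀ yc ∈ cubeLamS (F.P K).L a M' ρ' (K - n) (K - n) (K - n),
        κf (((-I) • lam) ∘ fun s : Site (F.P K) 0 => lift (F.P K) x₀ + rel x₀ s) (K - n) (coverAt (F.P K) (K - n) yc) = axialT (dbarIterU (K - n) (gaugeActT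
            (fun s => (u₁ (lift (F.P K) x₀ + rel x₀ s))⁻¹ * Unitary.toUnits (suIncl (gJ s)) : GaugeTransf (F.P K) 0 (Matrix (Fin 2) (Fin 2) ℂ)ˣ)
            (unitsField (toUField U)))) (iterBlockOf (K - n) x₀) (coverAt (F.P K) (K - n) yc)) →
      (∀ j, j ≤ K - n → ∀ b ∈ {b : LSite (F.P K).d × Fin (F.P K).d | SideTouches ((cubeFam false (F.P K).L a M' ρ' (K - n)) j) b.1 b.2},
        ‖lam b.1‖ ≤ α₄ ∧ wt (F.P K).L (((F.L : ℝ)⁻¹) ^ (K - n)) j * ‖covDerivFwd (((F.L : ℝ)⁻¹) ^ (K - n)) (1 : LSite (F.P K).d → Fin (F.P K).d → (Matrix (Fin 2) (Fin 2) ℂ)ˣ) b.2 lam b.1‖ ≤ α₄) →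
      Restr129 (F.P K).L (K - n) (cubeLamS (F.P K).L a M' ρ' (K - n) (K - n)) (1 : LSite (F.P K).d → Fin (F.P K).d → (Matrix (Fin 2) (Fin 2) ℂ)ˣ) u₁ →
      Restr129 (F.P K).L (K - n) (Function.update (cubeLamS (F.P K).L a M' ρ' (K - n) (K - n)) (K - n) ∅) (1 : LSite (F.P K).d → Fin (F.P K).d → (Matrix (Fin 2) (Fin 2) ℂ)ˣ) (u₁ * gaugeExp lam) →
      ∀ (u : LSite (F.P K).d → (Matrix (Fin 2) (Fin 2) ℂ)ˣ) (V' : LSite (F.P K).d → Fin (F.P K).d → (Matrix (Fin 2) (Fin 2) ℂ)ˣ) (A' : LSite (F.P K).d → Fin (F.P K).d → (Matrix (Fin 2) (Fin 2) ℂ)),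
      (∀ x, u x ∈ unitaryUnits (Matrix (Fin 2) (Fin 2) ℂ)) → mgauge (1 : LSite (F.P K).d → Fin (F.P K).d → (Matrix (Fin 2) (Fin 2) ℂ)ˣ) u V' = (pull (unitsField (toUField (GaugeField.gaugeAct gJ U))) 0) →
      Restr129 (F.P K).L (K - n) (Function.update (cubeLamS (F.P K).L a M' ρ' (K - n) (K - n)) (K - n) ∅) (1 : LSite (F.P K).d → Fin (F.P K).d → (Matrix (Fin 2) (Fin 2) ℂ)ˣ) u →
      (IsLandau138W (F.P K).L (K - n) (((F.L : ℝ)⁻¹) ^ (K - n)) ((cubeFam false (F.P K).L a M' ρ' (K - n)) 0) (cubeLamS (F.P K).L a M' ρ' (K - n) (K - n)) (1 : LSite (F.P K).d → Fin (F.P K).d → (Matrix (Fin 2) (Fin 2) ℂ)ˣ) V' ∧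
        (∀ c ∈ (cubeLamBP' (F.P K).L a M' ρ' (K - n) (K - n)) (K - n), ∀ (y : LSite (F.P K).d) (τ : Fin (F.P K).d),
          InBox (loK (F.P K).L (K - n) c.1) (bondHiK (F.P K).L (K - n) c.1 c.2) y → InBox (loK (F.P K).L (K - n) c.1) (bondHiK (F.P K).L (K - n) c.1 c.2) (y + e τ) →
          V' y τ = gaugeActT (fun s => ((u₁ * gaugeExp lam) (lift (F.P K) x₀ + rel x₀ s))⁻¹ * Unitary.toUnits (suIncl (gJ s)) : GaugeTransf (F.P K) 0 (Matrix (Fin 2) (Fin 2) ℂ)ˣ) (unitsField (toUField U)) ⟨cover (F.P K) y, τ⟩)) →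
      (∀ y τ, IsSelfAdjoint (A' y τ)) → (∀ j, j ≤ K - n → ∀ y τ, SideTouches ((cubeFam false (F.P K).L a M' ρ' (K - n)) j) y τ →
        V' y τ = cfgExp (((F.L : ℝ)⁻¹) ^ (K - n)) A' y τ ∧ ‖A' y τ‖ ≤ (2 * ((F.P K).L * cstar) + 8 * α₄) * (((F.P K).L : ℝ) ^ j * (((F.L : ℝ)⁻¹) ^ (K - n)))⁻¹) →
      (∀ y τ, (∀ j, j ≤ K - n → ¬ SideTouches ((cubeFam false (F.P K).L a M' ρ' (K - n)) j) y τ) → A' y τ = 0) →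
      ∀ c ∈ (cubeLamBP' (F.P K).L a M' ρ' (K - n) (K - n)) (K - n), c ∉ (cubeLamB (F.P K).L a M' ρ' (K - n) (K - n)) (K - n) →
        ‖logCovIter (F.P K).L (1 : LSite (F.P K).d → Fin (F.P K).d → (Matrix (Fin 2) (Fin 2) ℂ)ˣ) (iEta (((F.L : ℝ)⁻¹) ^ (K - n)) A') (K - n) c.1 c.2‖ < 2 * (F.P K).d * (F.P K).L * α₁)
    -- SOCKET `hT4Tγ`: Theorem 4's datum WITH ITS SUPPORT CLAUSE at every level for the pre-gauged field, ∀-closed over the member's `SU(2)` gauge UNDER J3's four rows (✓(γ-3a))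
    (hT4Tγ : ∀ gJ : GaugeTransf (F.P K) 0 (Matrix.specialUnitaryGroup (Fin 2) ℂ),
      InAk (F.P K).L (K - n) (((F.L : ℝ)⁻¹) ^ (K - n)) ε₀ (fun _ => (Set.univ : Set (LSite (F.P K).d))) (pull (unitsField (toUField (GaugeField.gaugeAct gJ U))) 0) →
      (∀ m', m' ≤ K - n → ∀ Λ : ℕ → Set (LSite (F.P K).d),
        InAx (F.P K).L m' Λ (1 : LSite (F.P K).d → Fin (F.P K).d → (Matrix (Fin 2) (Fin 2) ℂ)ˣ) (pull (unitsField (toUField (GaugeField.gaugeAct gJ U))) 0)) →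
      (∀ m', m' ≤ K - n → ∀ (x : LSite (F.P K).d) (ν : Fin (F.P K).d), tlo (F.P K).L (tLo a ρ') m' ≤ x → x + e ν ≤ thi (F.P K).L (tHi a M' ρ') m' →
        ‖((avgIter (F.P K).L (pull (unitsField (toUField (GaugeField.gaugeAct gJ U))) 0) (K - n - m') x ν : (Matrix (Fin 2) (Fin 2) ℂ)ˣ) : Matrix (Fin 2) (Fin 2) ℂ) - 1‖ < s) →
      (∀ (x : LSite (F.P K).d) (ν : Fin (F.P K).d), tlo (F.P K).L (tLo a ρ') (K - n) ≤ x → x + e ν ≤ thi (F.P K).L (tHi a M' ρ') (K - n) →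
        ‖((pull (unitsField (toUField (GaugeField.gaugeAct gJ U))) 0 x ν : (Matrix (Fin 2) (Fin 2) ℂ)ˣ) : Matrix (Fin 2) (Fin 2) ℂ) - 1‖ < s) →
      ∀ m, m ≤ K - n → ∃ u : LSite (F.P K).d → (Matrix (Fin 2) (Fin 2) ℂ)ˣ,
        (∀ x, ((u x : (Matrix (Fin 2) (Fin 2) ℂ)ˣ) : Matrix (Fin 2) (Fin 2) ℂ) ∈ Matrix.specialUnitaryGroup (Fin 2) ℂ) ∧
        (∀ x, x ∉ cubeFam false (F.P K).L a M' ρ' (K - n) 0 → u x = 1) ∧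
        Restr129 (F.P K).L m (cubeLamS (F.P K).L a M' ρ' (K - n) m) (1 : LSite (F.P K).d → Fin (F.P K).d → (Matrix (Fin 2) (Fin 2) ℂ)ˣ) u ∧
        ∃ W : LSite (F.P K).d → Fin (F.P K).d → (Matrix (Fin 2) (Fin 2) ℂ)ˣ,
          mgauge (1 : LSite (F.P K).d → Fin (F.P K).d → (Matrix (Fin 2) (Fin 2) ℂ)ˣ) u W = pull (unitsField (toUField (GaugeField.gaugeAct gJ U))) 0 ∧
          (1 ≤ m → IsLandau138W (F.P K).L m (((F.L : ℝ)⁻¹) ^ (K - n)) (cubeFam false (F.P K).L a M' ρ' (K - n) 0) (cubeLamS (F.P K).L a M' ρ' (K - n) m)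
            (1 : LSite (F.P K).d → Fin (F.P K).d → (Matrix (Fin 2) (Fin 2) ℂ)ˣ) W) ∧ ∃ A : LSite (F.P K).d → Fin (F.P K).d → Matrix (Fin 2) (Fin 2) ℂ, ∀ j, j ≤ m →
            ∀ b ∈ {b : LSite (F.P K).d × Fin (F.P K).d | SideTouches (cubeFam false (F.P K).L a M' ρ' (K - n) j) b.1 b.2},
              W b.1 b.2 = cfgExp (((F.L : ℝ)⁻¹) ^ (K - n)) A b.1 b.2 ∧ IsSelfAdjoint (A b.1 b.2) ∧ ‖A b.1 b.2‖ ≤ cstar * (((F.P K).L : ℝ) ^ j * ((F.L : ℝ)⁻¹) ^ (K - n))⁻¹)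
    -- EDITION γ: collar constant `B_∂` + SOCKET `H59Dγ`: Theorem 4's FLAT two-member (1.59) clause at truncation `K − n − 1` ([4] Thm 3.3 for `G(1)`, print's split class), ∀(`W`, `A′`)-closed
    (hBbd : 0 ≤ Bbd) (hBd : 4 * Bbd ≤ (((F.P K).d : ℝ) * (F.P K).L - 1) * B₀)
    (H59Dγ : ∀ (W : LSite (F.P K).d → Fin (F.P K).d → (Matrix (Fin 2) (Fin 2) ℂ)ˣ) (A' : LSite (F.P K).d → Fin (F.P K).d → (Matrix (Fin 2) (Fin 2) ℂ)),
      (∀ x κ, W x κ ∈ unitaryUnits (Matrix (Fin 2) (Fin 2) ℂ)) → InAk (F.P K).L (K - n - 1) (((F.L : ℝ)⁻¹) ^ (K - n)) ε₀ (cubeFam false (F.P K).L a M' ρ' (K - n)) W →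
      IsLandau138W (F.P K).L (K - n - 1) (((F.L : ℝ)⁻¹) ^ (K - n)) ((cubeFam false (F.P K).L a M' ρ' (K - n)) 0) (cubeLamS (F.P K).L a M' ρ' (K - n) (K - n - 1)) (1 : LSite (F.P K).d → Fin (F.P K).d → (Matrix (Fin 2) (Fin 2) ℂ)ˣ) W →
      (∀ y τ, IsSelfAdjoint (A' y τ)) → (∀ j, j ≤ K - n - 1 → ∀ (y : LSite (F.P K).d) (τ : Fin (F.P K).d), SideTouches ((cubeFam false (F.P K).L a M' ρ' (K - n)) j) y τ →
        W y τ = cfgExp (((F.L : ℝ)⁻¹) ^ (K - n)) A' y τ ∧ ‖A' y τ‖ ≤ cstar * (((F.P K).L : ℝ) ^ j * (((F.L : ℝ)⁻¹) ^ (K - n)))⁻¹) →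
      (∀ (y : LSite (F.P K).d) (τ : Fin (F.P K).d), (∀ j, j ≤ K - n - 1 → ¬ SideTouches ((cubeFam false (F.P K).L a M' ρ' (K - n)) j) y τ) → A' y τ = 0) →
      msup (F.P K).L (K - n - 1) (((F.L : ℝ)⁻¹) ^ (K - n)) (-(1 : ℝ)) (fun j (b : LSite (F.P K).d × Fin (F.P K).d) => SideTouches ((cubeFam false (F.P K).L a M' ρ' (K - n)) j) b.1 b.2) (fun b => A' b.1 b.2)
          ≤ B₀ * (bondNorm (F.P K).L (K - n - 1) (((F.L : ℝ)⁻¹) ^ (K - n)) (-(3 : ℝ)) (cubeFam false (F.P K).L a M' ρ' (K - n)) (fun x μ => Jcur (((F.L : ℝ)⁻¹) ^ (K - n)) (1 : LSite (F.P K).d → Fin (F.P K).d → (Matrix (Fin 2) (Fin 2) ℂ)ˣ) A' μ x)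
            + wsup 1 (fun p : {p : ℕ × (LSite (F.P K).d × Fin (F.P K).d) // p.1 ≤ K - n - 1 ∧ (p.2 ∈ (cubeLamBP' (F.P K).L a M' ρ' (K - n) (K - n - 1)) p.1 ∨ (p.1 = 0 ∧ CrossB ((cubeFam false (F.P K).L a M' ρ' (K - n)) 0) p.2))} => linCovIter (F.P K).L (1 : LSite (F.P K).d → Fin (F.P K).d → (Matrix (Fin 2) (Fin 2) ℂ)ˣ) (iEta (((F.L : ℝ)⁻¹) ^ (K - n)) A') p.1.1 p.1.2.1 p.1.2.2))
            + Bbd * msup (F.P K).L (K - n - 1) (((F.L : ℝ)⁻¹) ^ (K - n)) (-(1 : ℝ)) (fun j (b : LSite (F.P K).d × Fin (F.P K).d) => j = 0 ∧ SideTouches ((cubeFam false (F.P K).L a M' ρ' (K - n)) 0) b.1 b.2 ∧ ¬ BondTouches ((cubeFam false (F.P K).L a M' ρ' (K - n)) 0) b.1 b.2) (fun b => A' b.1 b.2) ∧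
        msup (F.P K).L (K - n - 1) (((F.L : ℝ)⁻¹) ^ (K - n)) (-(2 : ℝ)) (fun j (t : Fin (F.P K).d × Fin (F.P K).d × LSite (F.P K).d) => SideTouches ((cubeFam false (F.P K).L a M' ρ' (K - n)) j) t.2.2 t.2.1) (fun t => covDerivFwd (((F.L : ℝ)⁻¹) ^ (K - n)) (1 : LSite (F.P K).d → Fin (F.P K).d → (Matrix (Fin 2) (Fin 2) ℂ)ˣ) t.1 (fun z => A' z t.2.1) t.2.2)
          ≤ B₀ * (bondNorm (F.P K).L (K - n - 1) (((F.L : ℝ)⁻¹) ^ (K - n)) (-(3 : ℝ)) (cubeFam false (F.P K).L a M' ρ' (K - n)) (fun x μ => Jcur (((F.L : ℝ)⁻¹) ^ (K - n)) (1 : LSite (F.P K).d → Fin (F.P K).d → (Matrix (Fin 2) (Fin 2) ℂ)ˣ) A' μ x)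
            + wsup 1 (fun p : {p : ℕ × (LSite (F.P K).d × Fin (F.P K).d) // p.1 ≤ K - n - 1 ∧ (p.2 ∈ (cubeLamBP' (F.P K).L a M' ρ' (K - n) (K - n - 1)) p.1 ∨ (p.1 = 0 ∧ CrossB ((cubeFam false (F.P K).L a M' ρ' (K - n)) 0) p.2))} => linCovIter (F.P K).L (1 : LSite (F.P K).d → Fin (F.P K).d → (Matrix (Fin 2) (Fin 2) ℂ)ˣ) (iEta (((F.L : ℝ)⁻¹) ^ (K - n)) A') p.1.1 p.1.2.1 p.1.2.2))
            + Bbd * msup (F.P K).L (K - n - 1) (((F.L : ℝ)⁻¹) ^ (K - n)) (-(1 : ℝ)) (fun j (b : LSite (F.P K).d × Fin (F.P K).d) => j = 0 ∧ SideTouches ((cubeFam false (F.P K).L a M' ρ' (K - n)) 0) b.1 b.2 ∧ ¬ BondTouches ((cubeFam false (F.P K).L a M' ρ' (K - n)) 0) b.1 b.2) (fun b => A' b.1 b.2))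
    -- SOCKET: the [4] LETTERS at `(K − n, U₀ := 1)` as ONE package (✓p654110's `SLetτ`; VERBATIM ✓p659785∕✓p660425's)
    (SLetτ : ∃ (g Δ : (LSite (F.P K).d → (Matrix (Fin 2) (Fin 2) ℂ)) →ₗ[ℂ] (LSite (F.P K).d → (Matrix (Fin 2) (Fin 2) ℂ))) (q : (LSite (F.P K).d → (Matrix (Fin 2) (Fin 2) ℂ)) →ₗ[ℂ] (ℕ → LSite (F.P K).d → (Matrix (Fin 2) (Fin 2) ℂ)))
        (qs : (ℕ → LSite (F.P K).d → (Matrix (Fin 2) (Fin 2) ℂ)) →ₗ[ℂ] (LSite (F.P K).d → (Matrix (Fin 2) (Fin 2) ℂ))) (Aw c : (ℕ → LSite (F.P K).d → (Matrix (Fin 2) (Fin 2) ℂ)) →ₗ[ℂ] (ℕ → LSite (F.P K).d → (Matrix (Fin 2) (Fin 2) ℂ)))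
        (H' : XSpace (F.P K).d (K - n) (Matrix (Fin 2) (Fin 2) ℂ) →ₗ[ℂ] (LSite (F.P K).d → (Matrix (Fin 2) (Fin 2) ℂ))),
      (∀ x, ∀ y ∈ (cubeFam false (F.P K).L a M' ρ' (K - n)) 0, (Δ (g x) + qs (Aw (q (g x)))) y = x y) ∧ (∀ f, q (g (g (qs (c (q f))))) = q f) ∧
      (∀ (f : LSite (F.P K).d → (Matrix (Fin 2) (Fin 2) ℂ)), ∀ x ∈ (cubeFam false (F.P K).L a M' ρ' (K - n)) 0, Δ f x = covLap (((F.L : ℝ)⁻¹) ^ (K - n)) (1 : LSite (F.P K).d → Fin (F.P K).d → (Matrix (Fin 2) (Fin 2) ℂ)ˣ) (((cubeFam false (F.P K).L a M' ρ' (K - n)) 0).indicator f) x) ∧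
      (∀ (μ : ℕ → LSite (F.P K).d → (Matrix (Fin 2) (Fin 2) ℂ)), ∀ x ∈ (cubeFam false (F.P K).L a M' ρ' (K - n)) 0, qs μ x = QT (F.P K).L (K - n) (cubeLamS (F.P K).L a M' ρ' (K - n) (K - n)) (1 : LSite (F.P K).d → Fin (F.P K).d → (Matrix (Fin 2) (Fin 2) ℂ)ˣ) μ x) ∧
      (∀ (f : LSite (F.P K).d → (Matrix (Fin 2) (Fin 2) ℂ)) (j : ℕ), j ≤ K - n → ∀ y ∈ (cubeLamS (F.P K).L a M' ρ' (K - n) (K - n)) j, q f j y = QprimeIter (zdBlocking (F.P K).d (F.P K).L) (bgT (F.P K).L (1 : LSite (F.P K).d → Fin (F.P K).d → (Matrix (Fin 2) (Fin 2) ℂ)ˣ)) j f y) ∧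
      (∀ (X : XSpace (F.P K).d (K - n) (Matrix (Fin 2) (Fin 2) ℂ)) (x : LSite (F.P K).d), ‖H' X x‖ ≤ B₀'H * ‖X‖) ∧
      (∀ j, j ≤ K - n → ∀ (X : XSpace (F.P K).d (K - n) (Matrix (Fin 2) (Fin 2) ℂ)), ∀ p ∈ {b : LSite (F.P K).d × Fin (F.P K).d | SideTouches ((cubeFam false (F.P K).L a M' ρ' (K - n)) j) b.1 b.2},
        wt (F.P K).L (((F.L : ℝ)⁻¹) ^ (K - n)) j * ‖covDerivFwd (((F.L : ℝ)⁻¹) ^ (K - n)) (1 : LSite (F.P K).d → Fin (F.P K).d → (Matrix (Fin 2) (Fin 2) ℂ)ˣ) p.2 (H' X) p.1‖ ≤ B₀'H * ‖X‖) ∧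
      (∀ X : XSpace (F.P K).d (K - n) (Matrix (Fin 2) (Fin 2) ℂ), Bd2 (F.P K).L (((F.L : ℝ)⁻¹) ^ (K - n)) (K - n) (cubeFam false (F.P K).L a M' ρ' (K - n)) (covLap (((F.L : ℝ)⁻¹) ^ (K - n)) (1 : LSite (F.P K).d → Fin (F.P K).d → (Matrix (Fin 2) (Fin 2) ℂ)ˣ) (H' X)) (B₂' * ‖X‖)) ∧
      (∀ (X : XSpace (F.P K).d (K - n) (Matrix (Fin 2) (Fin 2) ℂ)) (x : LSite (F.P K).d), x ∉ (cubeFam false (F.P K).L a M' ρ' (K - n)) 0 → H' X x = 0) ∧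
      (∀ X Y : XSpace (F.P K).d (K - n) (Matrix (Fin 2) (Fin 2) ℂ), (∀ p, Y p = -star (X p)) → ∀ x, H' Y x = -star (H' X x)) ∧
      (∀ (Y : XSpace (F.P K).d (K - n) (Matrix (Fin 2) (Fin 2) ℂ)) (j : ℕ) (hj : j ≤ K - n) (y : LSite (F.P K).d), y ∈ (cubeLamS (F.P K).L a M' ρ' (K - n) (K - n)) j →
        QprimeIter (zdBlocking (F.P K).d (F.P K).L) (bgT (F.P K).L (1 : LSite (F.P K).d → Fin (F.P K).d → (Matrix (Fin 2) (Fin 2) ℂ)ˣ)) j (H' Y) y = Y (⟨j, Nat.lt_succ_of_le hj⟩, y)) ∧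
      (∀ (f : LSite (F.P K).d → (Matrix (Fin 2) (Fin 2) ℂ)) (r : ℝ), 0 ≤ r → Bd2 (F.P K).L (((F.L : ℝ)⁻¹) ^ (K - n)) (K - n) (cubeFam false (F.P K).L a M' ρ' (K - n)) f r →
        (∀ x, ‖g f x‖ ≤ BG * r) ∧ ∀ j, j ≤ K - n → ∀ p ∈ {b : LSite (F.P K).d × Fin (F.P K).d | SideTouches ((cubeFam false (F.P K).L a M' ρ' (K - n)) j) b.1 b.2},
          wt (F.P K).L (((F.L : ℝ)⁻¹) ^ (K - n)) j * ‖covDerivFwd (((F.L : ℝ)⁻¹) ^ (K - n)) (1 : LSite (F.P K).d → Fin (F.P K).d → (Matrix (Fin 2) (Fin 2) ℂ)ˣ) p.2 (g f) p.1‖ ≤ BG * r) ∧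
      (∀ (f : LSite (F.P K).d → (Matrix (Fin 2) (Fin 2) ℂ)) (x : LSite (F.P K).d), x ∉ (cubeFam false (F.P K).L a M' ρ' (K - n)) 0 → g f x = 0) ∧
      (∀ f : LSite (F.P K).d → (Matrix (Fin 2) (Fin 2) ℂ), (∀ j, j ≤ K - n → ∀ x ∈ (cubeFam false (F.P K).L a M' ρ' (K - n)) j, IsSelfAdjoint (f x)) → ∀ x, IsSelfAdjoint (g f x)) ∧
      (∀ (f : LSite (F.P K).d → (Matrix (Fin 2) (Fin 2) ℂ)) (r : ℝ), 0 ≤ r → Bd2 (F.P K).L (((F.L : ℝ)⁻¹) ^ (K - n)) (K - n) (cubeFam false (F.P K).L a M' ρ' (K - n)) f r → Bd2 (F.P K).L (((F.L : ℝ)⁻¹) ^ (K - n)) (K - n) (cubeFam false (F.P K).L a M' ρ' (K - n)) (f - g (qs (c (q (g f))))) (BR * r)) ∧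
      (∀ f : LSite (F.P K).d → (Matrix (Fin 2) (Fin 2) ℂ), (∀ j, j ≤ K - n → ∀ x ∈ (cubeFam false (F.P K).L a M' ρ' (K - n)) j, IsSelfAdjoint (f x)) → ∀ j, j ≤ K - n → ∀ x ∈ (cubeFam false (F.P K).L a M' ρ' (K - n)) j, IsSelfAdjoint ((f - g (qs (c (q (g f))))) x)) ∧
      (∀ X : XSpace (F.P K).d (K - n) (Matrix (Fin 2) (Fin 2) ℂ), (∀ p, trCLM (Fin 2) (X p) = 0) → ∀ x, trCLM (Fin 2) (H' X x) = 0) ∧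
      (∀ f : LSite (F.P K).d → (Matrix (Fin 2) (Fin 2) ℂ), (∀ j, j ≤ K - n → ∀ x ∈ (cubeFam false (F.P K).L a M' ρ' (K - n)) j, trCLM (Fin 2) (f x) = 0) → ∀ x, trCLM (Fin 2) (g f x) = 0) ∧
      (∀ f : LSite (F.P K).d → (Matrix (Fin 2) (Fin 2) ℂ), (∀ j, j ≤ K - n → ∀ x ∈ (cubeFam false (F.P K).L a M' ρ' (K - n)) j, trCLM (Fin 2) (f x) = 0) → ∀ j, j ≤ K - n → ∀ x ∈ (cubeFam false (F.P K).L a M' ρ' (K - n)) j, trCLM (Fin 2) ((f - g (qs (c (q (g f))))) x) = 0))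
    -- SOCKET `H59γ`: T4γ's (1.59) clause at the knit gauge — ∀ `gJ` (J3's three guards) ∕ ∀ `g′`; SUPPORT antecedent for `u`; PRINT's split class ∪ level-0 crossing bonds; `+ B_∂·Φ₀`
    (H59γ : ∀ (gJ : GaugeTransf (F.P K) 0 (Matrix.specialUnitaryGroup (Fin 2) ℂ)),
      InAk (F.P K).L (K - n) (((F.L : ℝ)⁻¹) ^ (K - n)) ε₀ (fun _ => (Set.univ : Set (LSite (F.P K).d))) (pull (unitsField (toUField (GaugeField.gaugeAct gJ U))) 0) →
      (∀ m', m' ≤ K - n → ∀ Λ : ℕ → Set (LSite (F.P K).d), InAx (F.P K).L m' Λ (1 : LSite (F.P K).d → Fin (F.P K).d → (Matrix (Fin 2) (Fin 2) ℂ)ˣ) (pull (unitsField (toUField (GaugeField.gaugeAct gJ U))) 0)) →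
      (∀ m', m' ≤ K - n → ∀ (x : LSite (F.P K).d) (ν : Fin (F.P K).d), tlo (F.P K).L (tLo a ρ') m' ≤ x → x + e ν ≤ thi (F.P K).L (tHi a M' ρ') m' →
        ‖((avgIter (F.P K).L (pull (unitsField (toUField (GaugeField.gaugeAct gJ U))) 0) (K - n - m') x ν : (Matrix (Fin 2) (Fin 2) ℂ)ˣ) : Matrix (Fin 2) (Fin 2) ℂ) - 1‖ < s) →
      ∀ (g' : GaugeTransf (F.P K) 0 (Matrix (Fin 2) (Fin 2) ℂ)ˣ) (u : LSite (F.P K).d → (Matrix (Fin 2) (Fin 2) ℂ)ˣ) (V' : LSite (F.P K).d → Fin (F.P K).d → (Matrix (Fin 2) (Fin 2) ℂ)ˣ)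
        (A' : LSite (F.P K).d → Fin (F.P K).d → (Matrix (Fin 2) (Fin 2) ℂ)),
      (∀ x, u x ∈ unitaryUnits (Matrix (Fin 2) (Fin 2) ℂ)) → (∀ x, x ∉ (cubeFam false (F.P K).L a M' ρ' (K - n)) 0 → u x = 1) →
      mgauge (1 : LSite (F.P K).d → Fin (F.P K).d → (Matrix (Fin 2) (Fin 2) ℂ)ˣ) u V' = (pull (unitsField (toUField (GaugeField.gaugeAct gJ U))) 0) →
      Restr129 (F.P K).L (K - n) (Function.update (cubeLamS (F.P K).L a M' ρ' (K - n) (K - n)) (K - n) ∅) (1 : LSite (F.P K).d → Fin (F.P K).d → (Matrix (Fin 2) (Fin 2) ℂ)ˣ) u →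
      (IsLandau138W (F.P K).L (K - n) (((F.L : ℝ)⁻¹) ^ (K - n)) ((cubeFam false (F.P K).L a M' ρ' (K - n)) 0) (cubeLamS (F.P K).L a M' ρ' (K - n) (K - n)) (1 : LSite (F.P K).d → Fin (F.P K).d → (Matrix (Fin 2) (Fin 2) ℂ)ˣ) V' ∧
        (∀ c ∈ (cubeLamBP' (F.P K).L a M' ρ' (K - n) (K - n)) (K - n), ∀ (y : LSite (F.P K).d) (τ : Fin (F.P K).d),
          InBox (loK (F.P K).L (K - n) c.1) (bondHiK (F.P K).L (K - n) c.1 c.2) y → InBox (loK (F.P K).L (K - n) c.1) (bondHiK (F.P K).L (K - n) c.1 c.2) (y + e τ) →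
          V' y τ = gaugeActT g' (unitsField (toUField U)) ⟨cover (F.P K) y, τ⟩)) → (∀ y τ, IsSelfAdjoint (A' y τ)) →
      (∀ j, j ≤ K - n → ∀ y τ, SideTouches ((cubeFam false (F.P K).L a M' ρ' (K - n)) j) y τ →
        V' y τ = cfgExp (((F.L : ℝ)⁻¹) ^ (K - n)) A' y τ ∧ ‖A' y τ‖ ≤ (2 * ((F.P K).L * cstar) + 8 * α₄) * (((F.P K).L : ℝ) ^ j * (((F.L : ℝ)⁻¹) ^ (K - n)))⁻¹) →
      (∀ y τ, (∀ j, j ≤ K - n → ¬ SideTouches ((cubeFam false (F.P K).L a M' ρ' (K - n)) j) y τ) → A' y τ = 0) →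
      msup (F.P K).L (K - n) (((F.L : ℝ)⁻¹) ^ (K - n)) (-(1 : ℝ)) (fun j (b : LSite (F.P K).d × Fin (F.P K).d) => SideTouches ((cubeFam false (F.P K).L a M' ρ' (K - n)) j) b.1 b.2) (fun b => A' b.1 b.2)
          ≤ B₀ * (bondNorm (F.P K).L (K - n) (((F.L : ℝ)⁻¹) ^ (K - n)) (-(3 : ℝ)) (cubeFam false (F.P K).L a M' ρ' (K - n)) (fun x μ => Jcur (((F.L : ℝ)⁻¹) ^ (K - n)) (1 : LSite (F.P K).d → Fin (F.P K).d → (Matrix (Fin 2) (Fin 2) ℂ)ˣ) A' μ x)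
            + wsup 1 (fun p : {p : ℕ × (LSite (F.P K).d × Fin (F.P K).d) // p.1 ≤ K - n ∧ (p.2 ∈ (cubeLamBP' (F.P K).L a M' ρ' (K - n) (K - n)) p.1 ∨ (p.1 = 0 ∧ CrossB ((cubeFam false (F.P K).L a M' ρ' (K - n)) 0) p.2))} => linCovIter (F.P K).L (1 : LSite (F.P K).d → Fin (F.P K).d → (Matrix (Fin 2) (Fin 2) ℂ)ˣ) (iEta (((F.L : ℝ)⁻¹) ^ (K - n)) A') p.1.1 p.1.2.1 p.1.2.2))
            + Bbd * msup (F.P K).L (K - n) (((F.L : ℝ)⁻¹) ^ (K - n)) (-(1 : ℝ)) (fun j (b : LSite (F.P K).d × Fin (F.P K).d) => j = 0 ∧ SideTouches ((cubeFam false (F.P K).L a M' ρ' (K - n)) 0) b.1 b.2 ∧ ¬ BondTouches ((cubeFam false (F.P K).L a M' ρ' (K - n)) 0) b.1 b.2) (fun b => A' b.1 b.2) ∧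
        msup (F.P K).L (K - n) (((F.L : ℝ)⁻¹) ^ (K - n)) (-(2 : ℝ)) (fun j (t : Fin (F.P K).d × Fin (F.P K).d × LSite (F.P K).d) => SideTouches ((cubeFam false (F.P K).L a M' ρ' (K - n)) j) t.2.2 t.2.1) (fun t => covDerivFwd (((F.L : ℝ)⁻¹) ^ (K - n)) (1 : LSite (F.P K).d → Fin (F.P K).d → (Matrix (Fin 2) (Fin 2) ℂ)ˣ) t.1 (fun z => A' z t.2.1) t.2.2)
          ≤ B₀ * (bondNorm (F.P K).L (K - n) (((F.L : ℝ)⁻¹) ^ (K - n)) (-(3 : ℝ)) (cubeFam false (F.P K).L a M' ρ' (K - n)) (fun x μ => Jcur (((F.L : ℝ)⁻¹) ^ (K - n)) (1 : LSite (F.P K).d → Fin (F.P K).d → (Matrix (Fin 2) (Fin 2) ℂ)ˣ) A' μ x)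
            + wsup 1 (fun p : {p : ℕ × (LSite (F.P K).d × Fin (F.P K).d) // p.1 ≤ K - n ∧ (p.2 ∈ (cubeLamBP' (F.P K).L a M' ρ' (K - n) (K - n)) p.1 ∨ (p.1 = 0 ∧ CrossB ((cubeFam false (F.P K).L a M' ρ' (K - n)) 0) p.2))} => linCovIter (F.P K).L (1 : LSite (F.P K).d → Fin (F.P K).d → (Matrix (Fin 2) (Fin 2) ℂ)ˣ) (iEta (((F.L : ℝ)⁻¹) ^ (K - n)) A') p.1.1 p.1.2.1 p.1.2.2))
            + Bbd * msup (F.P K).L (K - n) (((F.L : ℝ)⁻¹) ^ (K - n)) (-(1 : ℝ)) (fun j (b : LSite (F.P K).d × Fin (F.P K).d) => j = 0 ∧ SideTouches ((cubeFam false (F.P K).L a M' ρ' (K - n)) 0) b.1 b.2 ∧ ¬ BondTouches ((cubeFam false (F.P K).L a M' ρ' (K - n)) 0) b.1 b.2) (fun b => A' b.1 b.2)) :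
              ∃ (t : ℤ) (_ : 0 ≤ t) (_ : t ≤ (M' : ℤ) - 1) (gJ : GaugeTransf (F.P K) 0 (Matrix.specialUnitaryGroup (Fin 2) ℂ))
                (u₁ : LSite (F.P K).d → (Matrix (Fin 2) (Fin 2) ℂ)ˣ) (W : LSite (F.P K).d → Fin (F.P K).d → (Matrix (Fin 2) (Fin 2) ℂ)ˣ)
                (A : LSite (F.P K).d → Fin (F.P K).d → Matrix (Fin 2) (Fin 2) ℂ) (c₁ c' : ℝ)
                (κf : (Site (F.P K) 0 → Matrix (Fin 2) (Fin 2) ℂ) → (i : ℕ) → GaugeTransf (F.P K) i (Matrix (Fin 2) (Fin 2) ℂ)ˣ)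
                (lam : LSite (F.P K).d → Matrix (Fin 2) (Fin 2) ℂ) (α₄ cA : ℝ),
                (∀ z, ((u₁ z : (Matrix (Fin 2) (Fin 2) ℂ)ˣ) : Matrix (Fin 2) (Fin 2) ℂ) ∈ Matrix.specialUnitaryGroup (Fin 2) ℂ) ∧
                (mgauge (1 : LSite (F.P K).d → Fin (F.P K).d → (Matrix (Fin 2) (Fin 2) ℂ)ˣ) u₁ W = pull (unitsField (toUField (GaugeField.gaugeAct gJ U))) 0) ∧
                (∀ b ∈ {b : LSite (F.P K).d × Fin (F.P K).d | SideTouches (cubeFam false (F.P K).L (fun μ => ((iterBlockOf (K - n) x₀ μ).val : ℤ) - t) M' (ρ + M + L + S) (K - n) 0) b.1 b.2},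
      W b.1 b.2 = cfgExp (((F.L : ℝ)⁻¹) ^ (K - n)) A b.1 b.2) ∧ (0 ≤ c') ∧ (8 * 3800 * ((((F.P K).d + 2) * (F.P K).L : ℕ) : ℝ) ^ 2 * c' ≤ 1) ∧
                (Real.exp c₁ - 1 ≤ ((F.L : ℝ)⁻¹) ^ (K - n) * c') ∧
                (∀ z ∈ cube (F.P K).L (fun μ => ((iterBlockOf (K - n) x₀ μ).val : ℤ) - t) M' (ρ + M + L + S) (K - n) (K - n), ∀ ν : Fin (F.P K).d,
      W z ν = cfgExp (((F.L : ℝ)⁻¹) ^ (K - n)) A z ν ∧ ((F.L : ℝ)⁻¹) ^ (K - n) * ‖A z ν‖ ≤ c₁) ∧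
                (∀ (m : Site (F.P K) 0 → Matrix (Fin 2) (Fin 2) ℂ) (i : ℕ) (y : Site (F.P K) (i + 1)), κf m (i + 1) y = (vframeU (gaugeActT (κf m i) (dbarIterU i (gaugeActT
        (fun s => (u₁ (lift (F.P K) x₀ + rel x₀ s))⁻¹ * Unitary.toUnits (suIncl (gJ s)) : GaugeTransf (F.P K) 0 (Matrix (Fin 2) (Fin 2) ℂ)ˣ)
        (unitsField (toUField U))))) y)⁻¹ * κf m i (emb y) * vframeU (dbarIterU i (gaugeActT
          (fun s => (u₁ (lift (F.P K) x₀ + rel x₀ s))⁻¹ * Unitary.toUnits (suIncl (gJ s)) : GaugeTransf (F.P K) 0 (Matrix (Fin 2) (Fin 2) ℂ)ˣ) (unitsField (toUField U)))) y) ∧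
                (∀ (m : Site (F.P K) 0 → Matrix (Fin 2) (Fin 2) ℂ) (x : Site (F.P K) 0), ((κf m 0 x : (Matrix (Fin 2) (Fin 2) ℂ)ˣ) : Matrix (Fin 2) (Fin 2) ℂ) = exp (m x)) ∧
                (0 ≤ α₄) ∧ (α₄ ≤ 1 / 70) ∧ (0 ≤ cA) ∧ (cA ≤ 1 / 12) ∧ (∀ x, IsSelfAdjoint (lam x)) ∧ (∀ x, (lam x).trace = 0) ∧
                (∀ x, x ∉ cubeFam false (F.P K).L (fun μ => ((iterBlockOf (K - n) x₀ μ).val : ℤ) - t) M' (ρ + M + L + S) (K - n) 0 → lam x = 0) ∧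
                (∀ b ∈ {b : LSite (F.P K).d × Fin (F.P K).d | SideTouches (cubeFam false (F.P K).L (fun μ => ((iterBlockOf (K - n) x₀ μ).val : ℤ) - t) M' (ρ + M + L + S) (K - n) 0) b.1 b.2},
      ‖lam b.1‖ ≤ α₄ ∧ wt (F.P K).L (((F.L : ℝ)⁻¹) ^ (K - n)) 0 *
        ‖covDerivFwd (((F.L : ℝ)⁻¹) ^ (K - n)) (1 : LSite (F.P K).d → Fin (F.P K).d → (Matrix (Fin 2) (Fin 2) ℂ)ˣ) b.2 lam b.1‖ ≤ α₄) ∧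
                (∃ μ : ℕ → LSite (F.P K).d → Matrix (Fin 2) (Fin 2) ℂ, ∀ x ∈ cubeFam false (F.P K).L (fun μ => ((iterBlockOf (K - n) x₀ μ).val : ℤ) - t) M' (ρ + M + L + S) (K - n) 0,
      covLap (((F.L : ℝ)⁻¹) ^ (K - n)) (1 : LSite (F.P K).d → Fin (F.P K).d → (Matrix (Fin 2) (Fin 2) ℂ)ˣ)
        ((cubeFam false (F.P K).L (fun μ => ((iterBlockOf (K - n) x₀ μ).val : ℤ) - t) M' (ρ + M + L + S) (K - n) 0).indicator fun y =>
          covDivB (((F.L : ℝ)⁻¹) ^ (K - n)) (1 : LSite (F.P K).d → Fin (F.P K).d → (Matrix (Fin 2) (Fin 2) ℂ)ˣ) A y +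
          covLap (((F.L : ℝ)⁻¹) ^ (K - n)) (1 : LSite (F.P K).d → Fin (F.P K).d → (Matrix (Fin 2) (Fin 2) ℂ)ˣ) lam y +
          ((conjR (gaugeExp lam y)⁻¹ (covDivB (((F.L : ℝ)⁻¹) ^ (K - n)) (1 : LSite (F.P K).d → Fin (F.P K).d → (Matrix (Fin 2) (Fin 2) ℂ)ˣ) A y) -
              covDivB (((F.L : ℝ)⁻¹) ^ (K - n)) (1 : LSite (F.P K).d → Fin (F.P K).d → (Matrix (Fin 2) (Fin 2) ℂ)ˣ) A y) +
            (gAd (covLap (((F.L : ℝ)⁻¹) ^ (K - n)) (1 : LSite (F.P K).d → Fin (F.P K).d → (Matrix (Fin 2) (Fin 2) ℂ)ˣ) lam y) (lam y) -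
              covLap (((F.L : ℝ)⁻¹) ^ (K - n)) (1 : LSite (F.P K).d → Fin (F.P K).d → (Matrix (Fin 2) (Fin 2) ℂ)ˣ) lam y) +
            ∑ μ, frakF3 (((F.L : ℝ)⁻¹) ^ (K - n)) (1 : LSite (F.P K).d → Fin (F.P K).d → (Matrix (Fin 2) (Fin 2) ℂ)ˣ) lam A y μ)) x =
        QT (F.P K).L (K - n) (cubeLamS (F.P K).L (fun μ => ((iterBlockOf (K - n) x₀ μ).val : ℤ) - t) M' (ρ + M + L + S) (K - n) (K - n)) (1 : LSite (F.P K).d → Fin (F.P K).d → (Matrix (Fin 2) (Fin 2) ℂ)ˣ) μ x) ∧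
                (∀ yc ∈ cubeLamS (F.P K).L (fun μ => ((iterBlockOf (K - n) x₀ μ).val : ℤ) - t) M' (ρ + M + L + S) (K - n) (K - n) (K - n),
      κf (((-I) • lam) ∘ fun s : Site (F.P K) 0 => lift (F.P K) x₀ + rel x₀ s) (K - n) (coverAt (F.P K) (K - n) yc) = axialT (dbarIterU (K - n) (gaugeActT
          (fun s => (u₁ (lift (F.P K) x₀ + rel x₀ s))⁻¹ * Unitary.toUnits (suIncl (gJ s)) : GaugeTransf (F.P K) 0 (Matrix (Fin 2) (Fin 2) ℂ)ˣ)
          (unitsField (toUField U)))) (iterBlockOf (K - n) x₀) (coverAt (F.P K) (K - n) yc)) ∧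
                (∀ x ∈ cubeFam false (F.P K).L (fun μ => ((iterBlockOf (K - n) x₀ μ).val : ℤ) - t) M' (ρ + M + L + S) (K - n) 0, ∀ μ : Fin (F.P K).d,
      wt (F.P K).L (((F.L : ℝ)⁻¹) ^ (K - n)) 0 * ‖A x μ‖ ≤ cA ∧ wt (F.P K).L (((F.L : ℝ)⁻¹) ^ (K - n)) 0 *
          ‖conjR ((1 : LSite (F.P K).d → Fin (F.P K).d → (Matrix (Fin 2) (Fin 2) ℂ)ˣ) (x - e μ) μ)⁻¹ (A (x - e μ) μ)‖ ≤ cA) ∧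
                (∀ j, j ≤ K - n → ∀ z ∈ cube (F.P K).L (fun μ => ((iterBlockOf (K - n) x₀ μ).val : ℤ) - t) M' (ρ + M + L + S) (K - n) j, ∀ ν' : Fin (F.P K).d,
      (F.L : ℝ) ^ j * ((F.L : ℝ)⁻¹) ^ (K - n) * ‖logCfg (((F.L : ℝ)⁻¹) ^ (K - n)) (mgauge (1 : LSite (F.P K).d → Fin (F.P K).d → (Matrix (Fin 2) (Fin 2) ℂ)ˣ) (gaugeExp lam)⁻¹
          (cfgExp (((F.L : ℝ)⁻¹) ^ (K - n)) A)) z ν'‖ ≤ Bsz * ε₀) ∧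
                (∀ j, j ≤ K - n → ∀ z ∈ cube (F.P K).L (fun μ => ((iterBlockOf (K - n) x₀ μ).val : ℤ) - t) M' (ρ + M + L + S) (K - n) j, ∀ ν' μ' : Fin (F.P K).d,
      z + e μ' ∈ cube (F.P K).L (fun μ => ((iterBlockOf (K - n) x₀ μ).val : ℤ) - t) M' (ρ + M + L + S) (K - n) 0 →
      ((F.L : ℝ) ^ j * ((F.L : ℝ)⁻¹) ^ (K - n)) ^ 2 * (F.L : ℝ) ^ (K - n) *
        ‖logCfg (((F.L : ℝ)⁻¹) ^ (K - n)) (mgauge (1 : LSite (F.P K).d → Fin (F.P K).d → (Matrix (Fin 2) (Fin 2) ℂ)ˣ) (gaugeExp lam)⁻¹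
            (cfgExp (((F.L : ℝ)⁻¹) ^ (K - n)) A)) (z + e μ') ν' -
          logCfg (((F.L : ℝ)⁻¹) ^ (K - n)) (mgauge (1 : LSite (F.P K).d → Fin (F.P K).d → (Matrix (Fin 2) (Fin 2) ℂ)ˣ) (gaugeExp lam)⁻¹
            (cfgExp (((F.L : ℝ)⁻¹) ^ (K - n)) A)) z ν'‖ ≤ Bsz * ε₀) := by
  classical
  letI : CStarAlgebra (Matrix (Fin 2) (Fin 2) ℂ) := B10Eq29TubeLine.cstarAlgebraMatrix 2
  have hcs16 : cstar ≤ 1 / 16 := by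
    have h2 : 2 * cstar ≤ (F.P K).L * cstar := mul_le_mul_of_nonneg_right (by exact_mod_cast (F.P K).hL.2) (by rw [hc]; positivity); linarith only [h2, hs₂]
  obtain ⟨gJ, u₁, W, A, κf, hInAk, hInAx, htw, htree, hu₁SU, hu₁S, h129, hW, hLan, hdat, hAτ, hκfs, hκf0⟩ :=
    siteDatum_of_T4Tγ_tree F L hF hnK h2 ρ S M M' hρ'def hε₀ hε hsdef hs6 hroom V U hU x₀ ht0 ht hadef hcs16 hT4Tγ
  -- `H59Dγ` read at the datum (✓(γ-3b) `datumRowsγ`): Theorem 4's clause FOR THIS DATUM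
  have hu₁ : ∀ x, u₁ x ∈ unitaryUnits (Matrix (Fin 2) (Fin 2) ℂ) := fun x => specialUnitaryUnits_le_unitaryUnits (mem_specialUnitaryUnits.2 (hu₁SU x))
  have hU' : ∀ (x : LSite (F.P K).d) (κ : Fin (F.P K).d), pull (unitsField (toUField (GaugeField.gaugeAct gJ U))) 0 x κ ∈ unitaryUnits (Matrix (Fin 2) (Fin 2) ℂ) :=
    fun x κ => by rw [pull_apply]; exact unitsField_mem_unitaryUnits _ _
  obtain ⟨hWu, hIW⟩ := datumRowsγ (Nat.sub_le (K - n) 1) hU' hu₁ hW hInAk (cubeFam false (F.P K).L a M' ρ' (K - n))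
  have H59Dβm := fun A' hsa hUA hA0 => H59Dγ W A' hWu hIW hLan hsa hUA hA0
  obtain ⟨lam, hsa, hsupp, hτ0, h108, hmult, hlo, htopId, hA0⟩ :=
    siteTop_of_datum_γ F L hF hnK h2 ρ S M M' hρ'def hε₀ hroom U x₀ ht0 ht hadef hα₁ hB₀ hB₀' hsα₁ hc hα₄ hs₂ hside₀ hC₂ h61₀ hsmall₁
      hα3γ hα4γ h16γ hsmallγ hc₃γ
      hcBlo hcAlo hcDAlo hα3 hα4 hsmall hc₃ hsc hα₃' hs₁ hs₂' hs₃ hs₄ hs₅ hs₆ hs₇ hprod8 hcA13 hCblo hCllo hCbρ hClB hB₀'H hB₂' hBG hBR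
      hσ hδ hω hτ₀ hbudget hm hm₀ hr hCb₀ hCl₀ hwin SLetτ gJ u₁ W A κf hInAk hInAx htw hu₁SU hu₁S h129 hW hLan hdat hAτ hBbd hBd H59Dβm hκfs hκf0
  subst hadef hρ'def; have hd2 : 2 ≤ (F.P K).d := (by rw [T3Family.P_d F K]; norm_num); have hL2 : 2 ≤ (F.P K).L := (F.P K).hL.2
  have hL1 : 1 ≤ (F.P K).L := le_trans (by norm_num) hL2; have hLF : (F.P K).L = F.L := rfl
  have hLr1 : (1 : ℝ) ≤ (F.P K).L := (by exact_mod_cast hL1); have hρL : (F.P K).L ≤ ρ + M + L + S := by rw [hLF, hF]; omega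
  have hcs0 : 0 ≤ cstar := (by rw [hc]; positivity); have hα₄pos : 0 < α₄ := by rw [hα₄]; positivity
  have ha := corner_of_offset x₀ (K - n) (M' := M') ht0 ht; obtain ⟨hroomW, -, -⟩ := HalvingHSiteDatumOfSockets.member_windows F L hF hnK ρ S M M' (ε₀ := ε₀) hroom x₀ ht0 ht
  obtain ⟨m, hkm⟩ : ∃ m, K - n = m + 1 := ⟨K - n - 1, by omega⟩
  have hmK : K - n - 1 = m := (by omega); have hηm : 0 < ((F.L : ℝ)⁻¹) ^ (m + 1) := (by positivity); rw [hmK] at hdat hAτ h129 hLan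
  -- the trace of `λ′`, the chart on the touched sides of `□₀`, the chart-with-size on `□_k`, `c₁`, `c′`
  have htr : ∀ x, (lam x).trace = 0 := fun x => by rw [← trCLM_apply]; exact hτ0 x
  have hchart₀ : ∀ b ∈ {b : LSite (F.P K).d × Fin (F.P K).d |
        SideTouches (cubeFam false (F.P K).L (fun μ => ((iterBlockOf (K - n) x₀ μ).val : ℤ) - t) M' (ρ + M + L + S) (K - n) 0) b.1 b.2},
      W b.1 b.2 = cfgExp (((F.L : ℝ)⁻¹) ^ (K - n)) A b.1 b.2 :=
    fun b hb => (hdat 0 (Nat.zero_le _) b hb).1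
  have hdat' := hdat; rw [hkm] at hdat'
  have hchartTopm := hchartTop_of_hdat (𝔸 := Matrix (Fin 2) (Fin 2) ℂ) hd2 _ M' (ρ + M + L + S) m hηm hdat'
  have hchartTop : ∀ z ∈ cube (F.P K).L (fun μ => ((iterBlockOf (K - n) x₀ μ).val : ℤ) - t) M' (ρ + M + L + S) (K - n) (K - n), ∀ ν : Fin (F.P K).d,
      W z ν = cfgExp (((F.L : ℝ)⁻¹) ^ (K - n)) A z ν ∧ (((F.L : ℝ)⁻¹) ^ (K - n)) * ‖A z ν‖ ≤ cstar * (((F.P K).L : ℝ) ^ m)⁻¹ := by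
    rw [hkm]; exact hchartTopm
  have hcsm1 : cstar * (((F.P K).L : ℝ) ^ m)⁻¹ ≤ 1 := by
    have h1 : (((F.P K).L : ℝ) ^ m)⁻¹ ≤ 1 := inv_le_one_of_one_le₀ (one_le_pow₀ hLr1); have h3 : cstar ≤ (F.P K).L * cstar := le_mul_of_one_le_left hcs0 hLr1
    calc cstar * (((F.P K).L : ℝ) ^ m)⁻¹ ≤ 1 * 1 := mul_le_mul (by linarith only [h3, hs₂]) h1 (by positivity) (by norm_num)
      _ = 1 := one_mul _
  have hc₁ : Real.exp (cstar * (((F.P K).L : ℝ) ^ m)⁻¹) - 1 ≤ (((F.L : ℝ)⁻¹) ^ (K - n)) * (2 * (F.P K).L * cstar) := by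
    have h := hc₁_of_small hL1 m hcs0 hcsm1; rw [hkm]; exact h
  have hbudget' : 8 * 3800 * ((((F.P K).d + 2) * (F.P K).L : ℕ) : ℝ) ^ 2 * (2 * (F.P K).L * cstar) ≤ 1 :=
    le_trans (mul_le_mul_of_nonneg_left hσ (by positivity)) hbudget
  -- the knit clause at the datum (✓p655738); the sockets at the top-knit gauge `g′ := ((u₁·e^{iλ′}) ∘ rep)⁻¹·ĝJ`
  have hknit := hknit_of_descent_BP' x₀ hρL ha hroomW U gJ hu₁ hW hsa
  -- (R1)(R2) (v3.2; ym-ust-20520-w5 g9): the (1.29) rows of `u₁` AT truncation `k` (lit ✓`restr129_succ_of_truncation`) and of the composite `u₁·e^{iλ′}` with the top EMPTIED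
  -- (✓`restr129_product_of_topRows`, (1.68)–(1.69)∕(1.78)–(1.79)) — both CONSUMER-HELD (the very rows ✓`siteSizeRows_of_topRows_γ` derives inside), handed to `H42topCrossT`'s inhabitant
  have hInAkm := hInAk; have hInAxm := hInAx; have h129m := h129; have h108m := h108; have hlom := hlo; rw [hkm] at hInAkm hInAxm h129m h108m hlom
  have h129K := restr129_succ_of_truncation (U₀ := (1 : LSite (F.P K).d → Fin (F.P K).d → (Matrix (Fin 2) (Fin 2) ℂ)ˣ)) hL1
    (h8lt_cubeLamS (F.P K).L _ M' (ρ + M + L + S) (m + 1) m (lt_add_one m)) (h8top_cubeLamS hL1 _ M' (ρ + M + L + S) (m + 1) m (lt_add_one m)) h129m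
  have h129c := restr129_product_of_topRows hd2 hL2 hηm (hΩ_cubeFam hL1 _ M' hρL (m + 1)) (lt_add_one m) (htw_cubeLamS hL1 _ M' (ρ + M + L + S) (m + 1) (m + 1) le_rfl)
    (h8lt_cubeLamS (F.P K).L _ M' (ρ + M + L + S) (m + 1) m (lt_add_one m)) (h8top_cubeLamS hL1 _ M' (ρ + M + L + S) (m + 1) m (lt_add_one m)) hε₀ hα₁ hB₀ hα₄pos hc
    (one_inAk hL1 (m + 1) hηm hε₀ _) (h34_of_inAk_univ hInAkm _) (hAx_of_inAx_one hInAxm _) hu₁ hW h129m hdat' hcBlo hα3 hα4 hsmall hc₃ hsc hα₃' hs₁ hs₂' hs₃ hs₄ hs₅ hs₆ hprod8 h108m hlom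
  rw [← hkm] at h129K h129c  -- back to the binder's `K − n` letters
  -- (1.42) at the knit gauge: inner top class by the `HTOP` instance (ε₁-route), collar bonds by the datum-closed `H42topCrossT` instantiated at the datum (✓`H42_of_rows_γD`)
  have htop := HTOP gJ u₁ W A (cstar * (((F.P K).L : ℝ) ^ m)⁻¹) (2 * (F.P K).L * cstar) κf lam hu₁SU hW (by positivity) hbudget' hc₁ hchartTop hκfs hκf0 hsa htr htopId
  have hα₂ : 0 ≤ 2 * ((F.P K).L * cstar) + 8 * α₄ := (by positivity); have htwα := fun m' hm' x ν h1 h2 => lt_of_lt_of_le (htw m' hm' x ν h1 h2) hsα₁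
  have hr42' := hr42; have hr2' := hr2; rw [hmK] at hr42' hr2'
  have H42' := H42_of_rows_γD F hd2 hnK x₀ hρL ha hroomW hε₀ U gJ hInAk hInAx htwα hu₁ hW hchartTop hsa h108 htop hα₁ hα₂ hα3γ hα4γ h16Pγ hsmallPγ hc₃Pγ hsmall₁
    hkb hbudget42 hr42' hr2' hwin42
    (H42topCrossT gJ u₁ W A (cstar * (((F.P K).L : ℝ) ^ m)⁻¹) (2 * (F.P K).L * cstar) κf lam hInAk hInAx htw htree hu₁SU hW (by positivity) hbudget' hc₁ hchartTop hκfs hκf0 hsa htr htopId h108 h129K h129c)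
  have H59' := H59γ gJ hInAk hInAx htw (fun s => ((u₁ * gaugeExp lam) (lift (F.P K) x₀ + rel x₀ s))⁻¹ * Unitary.toUnits (suIncl (gJ s)))
  -- T4γ's β rows at `aβ := s` (✓(γ-3b)): (1.66)₀ on the sides touching `□₀` off J3's tower row (d) at depth `K − n`, and the three scalar rows
  have h66 := h66_of_towerRow hL2 (le_trans hL1 hρL) htw; have hs0 : 0 ≤ s := by
    have hM1 : (1 : ℝ) ≤ M' := (by exact_mod_cast (show 1 ≤ M' by omega)); have hρ0 : (0 : ℝ) ≤ ((ρ + M + L + S : ℕ) : ℝ) := Nat.cast_nonneg _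
    rw [hsdef]; exact mul_nonneg (by linarith) hε₀.le
  obtain ⟨hs4, hsdL, hbdry⟩ := betaScalarRows (by exact_mod_cast (show 1 ≤ (F.P K).d by omega) : (1 : ℝ) ≤ (F.P K).d) hLr1 hs0 hs6 hsα₁ hα₁ hε₀ hB₀ hBd
  have hηL : (((F.L : ℝ)⁻¹) ^ (m + 1))⁻¹ = ((F.P K).L : ℝ) ^ (m + 1) := by rw [hLF, inv_pow, inv_inv]
  have hInAk' := hInAk; have hInAx' := hInAx; have h129' := h129; have hsupp' := hsupp; have h108' := h108; have hmult' := hmult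
  have hlo' := hlo; have hA0' := hA0; have hknit' := hknit; have hu₁S' := hu₁S; have h66' := h66
  rw [hkm] at hInAk' hInAx' H42' H59' h129' hsupp' h108' hmult' hlo' hA0' hknit' hu₁S' h66'
  -- THE SIZES at the member (✓p654113 at `m := K − n − 1`, `Bε := Bsz·ε₀`)
  obtain ⟨hX1, hX2⟩ := siteSizeRows_of_topRows_γ (𝔸 := Matrix (Fin 2) (Fin 2) ℂ) hd2 hηm hL2 (a := fun μ => ((iterBlockOf (m + 1) x₀ μ).val : ℤ) - t)
    (M' := M') hρL (m := m) rfl rfl rfl hU' hε₀ hα₁ hα₄pos hB₀ hc hInAk' hInAx'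
    hα3γ hα4γ h16 hd5 hsmallPγ hc₃Pγ hside h50 hC₂ h61 hBbd hs0 hs4 hbdry hsdL h66' hcBlo hsmall hc₃ hsc hα₃' hs₁ hs₂' hs₃ hs₄ hs₅ hs₆ hprod8 _
    H42' H59' hu₁ hu₁S' hW h129' hdat' hα70 hcA0 hcA12 hsa hsupp' h108' hmult' hlo' hA0' hknit' hcsB hηL
  refine ⟨t, ht0, ht, gJ, u₁, W, A, cstar * (((F.P K).L : ℝ) ^ m)⁻¹, 2 * (F.P K).L * cstar, κf, lam, α₄, cA,
    hu₁SU, hW, hchart₀, by positivity, hbudget', hc₁, hchartTop, hκfs, hκf0, hα₄pos.le, hα70, hcA0, hcA12, hsa, htr, hsupp,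
    h108 0 (Nat.zero_le _), hmult, htopId, hA0, ?_, ?_⟩
  · rw [hkm]; exact hX1
  · rw [hkm]; exact hX2

end Summit.QuantumFields.YangMills.Theorems.HalvingHSiteRowsOfSocketsTGammaR
end
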